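import Summits.HodgeConjecture.HodgeConjecture.Theorems.F0P3GenIrreducibleOfUnitary   -- ★ B1 (F0P3-p02 (g3)): `weight_injective`; imports ★ `F0P3bPNullGeneration` (`grade`, `gen`)
import Literature.NumberTheory.Automorphic.GKModulesOneParameter                      -- ★ `IsGKModule.apply_mem_of_expK_stable`
import Mathlib.RepresentationTheory.Irreducible                                        -- Mathlib Schur: `algebraMap_intertwiningMap_bijective_of_isAlgClosed`
import HarnessLib

/-!
# Crux `H413` — RUNG 1½ «ISOTYPY FROM A NULL CORE», brick B4d: the `(𝔤, K)`-submodule generated by a finite-dimensional null core is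
# ADMISSIBLE (every `K`-type occurs in ONE `z₀`-grade)

Floor-0 programme P3 «U3-mult», seat F0P3-p03 (g4); crux item stmt-HodgeConjecture-24833 (`HCCMUnconditional.H413`); rung-1 line
`Cruxes/H413/Lines/F0_U3LettersRung1.lean` ed. 2.1, stub `stub_F1a_cm : StubF1aCM`; road «F1a in-house at the pin» (F0P3-p02 (g3),
`F0/P3/F0P3-p02/ROAD-F1a-inhouse.F0P3p02g3.md`, step B4b (v) «`↥gen` admissible: `K`-types have a `z₀`-weight, grade `n` f.d.»; consumed by
★ `F0P3ArchIsotypyOfIrreducibleCore.archIsotypy_of_core'` (F0P3-p01 (g4)) through its binder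
`hadm : IsAdmissibleGK (V := ↥core) (ρK.subrepresentation core _)`).  HC_CM is proved only modulo the printed citations until rung 0 closes.

Currency = the T6 layer's (★ `F0P3bPPartOperators`, ★ `F0P3bPNullGeneration`): a `(𝔤, K)`-module `(ρK, ρ𝔤)` of `U(α, β) = uFormGroup α β`
on a complex vector space `V` (`IsGKModule`, needed for `ad_compat` and the weak derivative along `𝔨`), a FINITE-DIMENSIONAL subspace `E ≤ V` of
`z₀`-weight `w` (`hw`; `μ² = −1`), its graded pieces `G_n = grade ρ𝔤 μ E n` (`G₀ = E`, `G_{n+1} = Σ_s P(x_s) G_n ⊆ eigenspace(ρz₀, w + nμ)`) and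
the generated subspace `gen ρ𝔤 μ E = ⨆ G_n`.  NOTHING ELSE: no nullity of `E`, no `𝔨`∕`K`-stability of `E`, no unitarity, no irreducibility.

THE MATHEMATICS ([BorelWallach2000, 0 §2.4; II §4.1]; [KnappVogan1995, §I.3 (before Prop. 1.63), §II.4]; [HarishChandraTAMS1953, §9]).
`z₀ = diag(i·1_α, 0_β)` is central in `𝔨` and `Ad(K)`-fixed (★ `upq_Ad_upqZ0`), so `ρz₀` commutes with `ρK` (`ad_compat`) and preserves every
`K`-stable subspace (the weak derivative of `t ↦ ρK(exp t z₀)`, ★ `IsGKModule.apply_mem_of_expK_stable`).  Hence for an IRREDUCIBLE finite-dimensional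
`K`-type `τ` and a `K`-map `φ : τ → U` (`U ≤ V` `K`-stable), `φ⁻¹ ∘ ρz₀ ∘ φ` is a `K`-endomorphism of `τ`, a SCALAR by Schur (Mathlib
`Representation.IsIrreducible.algebraMap_intertwiningMap_bijective_of_isAlgClosed`): the image of `φ` consists of `ρz₀`-eigenvectors for ONE
eigenvalue `c_φ` (§2).  Inside `gen`, a `z₀`-eigenvector lies in a SINGLE graded piece (§3: the `G_n` sit in eigenspaces for the pairwise distinct
weights `w + nμ`, which are independent — Mathlib `Module.End.eigenspaces_iSupIndep`; induction along the filtration `G₀ ⊔ ⋯ ⊔ G_m`), and two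
non-zero `K`-maps `φ, φ₀ : τ → U ≤ gen` see the SAME piece (apply §2 to `φ + φ₀`).  So `Hom_K(τ, U) ↪ Hom_ℂ(τ, G_{n₀})`, finite-dimensional:
**`isAdmissibleGK_subrepresentation_of_le_gen`** (§4) — every `K`-stable `U ≤ gen ρ𝔤 μ E` with its restricted `K`-action
(`ρK.subrepresentation U hK`, the currency of ★ `F0P3ArchIsotypyOfIrreducibleCore`) is ADMISSIBLE (`IsAdmissibleGK`), in particular `gen` itself
(`isAdmissibleGK_subrepresentation_gen`, under `K`-stability of `E`).

* §1 `upqZ0_apply_mem_partialSups` (`ρz₀` preserves the stages), `disjoint_grade_of_ne`, `disjoint_partialSups_grade_succ` (independence of `z₀`-eigenspaces,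
  Mathlib `Module.End.eigenspaces_iSupIndep`; the finite-dimensionality of the `G_n` and the exhaustion of `gen` by the stages — ★ B1∕B4a in the
  inner-product currency — are re-derived inline for bare modules).
* §2 `K_upqZ0_comm` (`ρK k ∘ ρz₀ = ρz₀ ∘ ρK k`), `upqZ0_coe_mem_compactLie`, `inclusion_upqZ0`, `upqZ0_apply_mem_of_K_stable`, **`exists_upqZ0_eq_smul_of_intertwiningMap`** (Schur).
* §3 **`exists_grade_of_eigenvector`** (a non-zero `z₀`-eigenvector of `gen` lies in one `G_n`, with eigenvalue `w + nμ`), `eq_of_add_eigenvector`.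
* §4 **`isAdmissibleGK_subrepresentation_of_le_gen`**, `isAdmissibleGK_subrepresentation_gen`.

No definition, no sorry, no named fact; `--supports stmt-HodgeConjecture-24833`.

References: [BorelWallach2000] A. Borel, N. Wallach, 2nd ed. (2000), 0 §2.4 (admissible: isotypic subspaces finite-dimensional), II §4.1;
[KnappVogan1995] A. Knapp, D. Vogan (1995), §I.3 (admissible `K`-representations), §II.4; [HarishChandraTAMS1953] Harish-Chandra, Trans. AMS 75
(1953), §9.
-/

-- Mathlib idiom (as in `GKModules`, the T6 layer and B1): commutator bracket on `Module.End`
attribute [local instance 100] LieRing.ofAssociativeRing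

set_option autoImplicit false
-- the mandated namespace repeats `HodgeConjecture.HodgeConjecture`, as in every `Theorems/*.lean` of this sub-problem
set_option linter.dupNamespace false

noncomputable section

namespace Summit.HodgeConjecture.HodgeConjecture.Cruxes.H413.F0P3GenAdmissible

open Literature.Algebra.Lie Literature.Algebra.Lie.ChevalleyEilenberg
open Literature.NumberTheory.Automorphic
open Literature.RepresentationTheory.BorelWallach2000
open Literature.RepresentationTheory.KonnoKonno2007 Literature.RepresentationTheory.KonnoKonno2007.RealDualPair
open Literature.RepresentationTheory.KonnoKonno2007.RealDualPair.UForm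
open Summit.HodgeConjecture.HodgeConjecture.Cruxes.H413.F0P3bPPartOperators
open Summit.HodgeConjecture.HodgeConjecture.Cruxes.H413.F0P3bPNullGeneration
open Summit.HodgeConjecture.HodgeConjecture.Cruxes.H413.F0P3GenIrreducibleOfUnitary (weight_injective)

variable {α β : Type} [Fintype α] [DecidableEq α] [Fintype β] [DecidableEq β]
variable {V : Type} [AddCommGroup V] [Module ℂ V]
  {ρK : Representation ℂ (uFormGroup α β).maximalCompact V} {ρ𝔤 : (uFormGroup α β).lie →ₗ⁅ℝ⁆ Module.End ℂ V}
  {μ : ℂ} {E : Submodule ℂ V}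

/-! ## §1 Grades: the stages `G₀ ⊔ ⋯ ⊔ G_m` are `z₀`-stable; grades and stages are independent -/

/-- **`ρz₀` preserves each stage `G₀ ⊔ ⋯ ⊔ G_m`** (it is the scalar `w + nμ` on `G_n`, ★ `z0_apply_of_mem_grade`). [cite: BorelWallach2000, II §4.1] -/
theorem upqZ0_apply_mem_partialSups (hμ : μ * μ = -1) {w : ℂ} (hw : ∀ e ∈ E, ρ𝔤 (upqZ0 α β) e = w • e) :
    ∀ (m : ℕ) {v : V}, v ∈ partialSups (grade ρ𝔤 μ E) m → ρ𝔤 (upqZ0 α β) v ∈ partialSups (grade ρ𝔤 μ E) m := by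
  intro m
  induction m with
  | zero =>
    intro v hv
    rw [partialSups_zero] at hv ⊢
    rw [z0_apply_of_mem_grade hμ hw 0 hv]
    exact Submodule.smul_mem _ _ hv
  | succ m ih =>
    intro v hv
    have hps : partialSups (grade ρ𝔤 μ E) (m + 1) = partialSups (grade ρ𝔤 μ E) m ⊔ grade ρ𝔤 μ E (m + 1) :=
      partialSups_succ _ m
    rw [hps] at hv ⊢
    obtain ⟨u, hu, g, hg, rfl⟩ := Submodule.mem_sup.1 hv
    rw [map_add, z0_apply_of_mem_grade hμ hw (m + 1) hg]
    exact Submodule.add_mem_sup (ih hu) (Submodule.smul_mem _ _ hg)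

/-- **Distinct graded pieces are independent**: `G_n ⊓ G_m = ⊥` for `n ≠ m` (they lie in eigenspaces of `ρz₀` for the distinct weights `w + nμ ≠ w + mμ`,
Mathlib `Module.End.eigenspaces_iSupIndep`). [cite: BorelWallach2000, II §4.1] -/
theorem disjoint_grade_of_ne (hμ : μ * μ = -1) {w : ℂ} (hw : ∀ e ∈ E, ρ𝔤 (upqZ0 α β) e = w • e) {n m : ℕ} (h : n ≠ m) :
    Disjoint (grade ρ𝔤 μ E n) (grade ρ𝔤 μ E m) :=
  ((Module.End.eigenspaces_iSupIndep (ρ𝔤 (upqZ0 α β))).pairwiseDisjoint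
      (fun heq : w + n * μ = w + m * μ => h (weight_injective hμ w heq))).mono
    (grade_le_eigenspace hμ hw n) (grade_le_eigenspace hμ hw m)

/-- **A stage `G₀ ⊔ ⋯ ⊔ G_m` is independent of the next piece `G_{m+1}`** (its weights `w + kμ`, `k ≤ m`, all differ from `w + (m+1)μ`).
[cite: BorelWallach2000, II §4.1] -/
theorem disjoint_partialSups_grade_succ (hμ : μ * μ = -1) {w : ℂ} (hw : ∀ e ∈ E, ρ𝔤 (upqZ0 α β) e = w • e) (m : ℕ) :
    Disjoint (partialSups (grade ρ𝔤 μ E) m) (grade ρ𝔤 μ E (m + 1)) := by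
  set T : Module.End ℂ V := ρ𝔤 (upqZ0 α β) with hT
  set y : Set ℂ := (fun k : ℕ => w + k * μ) '' Set.Iic m with hy
  have hc : w + ((m + 1 : ℕ) : ℂ) * μ ∉ y := by
    rintro ⟨k, hk, hk'⟩
    have : k = m + 1 := weight_injective hμ w hk'
    exact absurd (Set.mem_Iic.1 hk) (by omega)
  have hdisj := (Module.End.eigenspaces_iSupIndep T).disjoint_biSup hc
  refine hdisj.symm.mono ?_ (grade_le_eigenspace hμ hw (m + 1))
  refine (partialSups_le_iff).2 fun k hk => (grade_le_eigenspace hμ hw k).trans ?_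
  exact le_biSup T.eigenspace (show w + (k : ℂ) * μ ∈ y from ⟨k, Set.mem_Iic.2 hk, rfl⟩)

/-! ## §2 `z₀` in a `(𝔤, K)`-module of `U(α, β)`: commutes with `K`, preserves `K`-stable subspaces, is a scalar on the image of an irreducible `K`-type -/

/-- **`ρK k (ρz₀ v) = ρz₀ (ρK k v)`** (`ad_compat` + `Ad k z₀ = z₀`, ★ `upq_Ad_upqZ0`). [cite: BorelWallach2000, I §5.1 (1); II §4.1] -/
theorem K_upqZ0_comm (hGK : IsGKModule (uFormGroup α β) ρK ρ𝔤) (k : (uFormGroup α β).maximalCompact) (v : V) :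
    ρK k (ρ𝔤 (upqZ0 α β) v) = ρ𝔤 (upqZ0 α β) (ρK k v) := by
  have h : ρK k (ρ𝔤 (upqZ0 α β) v) =
      ρ𝔤 ((uFormGroup α β).Ad (Subgroup.inclusion (uFormGroup α β).maximalCompact_le_carrier k) (upqZ0 α β)) (ρK k v) :=
    (gkPairAction (uFormGroup α β) ρK ρ𝔤 hGK.ad_compat).compat k (upqZ0 α β) v
  rwa [upq_Ad_upqZ0] at h

/-- The matrix of `z₀` lies in `compactLie` (`z₀ ∈ 𝔨`, ★ `upqZ0_mem_kInLie`). [cite: BorelWallach2000, II §4.1] -/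
theorem upqZ0_coe_mem_compactLie :
    ((upqZ0 α β : (uFormGroup α β).lie) : Matrix (α ⊕ β) (α ⊕ β) ℂ) ∈ (uFormGroup α β).compactLie :=
  ((uFormGroup α β).mem_kInLie_iff _).1 upqZ0_mem_kInLie

/-- `z₀` read in `compactLie` includes back to `z₀ ∈ 𝔤`. [cite: BorelWallach2000, II §4.1] -/
theorem inclusion_upqZ0 :
    LieSubalgebra.inclusion (uFormGroup α β).compactLie_le_lie ⟨_, upqZ0_coe_mem_compactLie (α := α) (β := β)⟩ = upqZ0 α β := rfl

/-- **`ρz₀` preserves every `K`-stable subspace** (`z₀ ∈ 𝔨` and the weak derivative of `t ↦ ρK (exp t z₀) u ∈ U`, ★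
`IsGKModule.apply_mem_of_expK_stable`). [cite: BorelWallach2000, 0 §2.4] [cite: KnappVogan1995, §I.3] -/
theorem upqZ0_apply_mem_of_K_stable (hGK : IsGKModule (uFormGroup α β) ρK ρ𝔤) {U : Submodule ℂ V}
    (hK : ∀ k : (uFormGroup α β).maximalCompact, U ≤ U.comap (ρK k)) {u : V} (hu : u ∈ U) :
    ρ𝔤 (upqZ0 α β) u ∈ U := by
  have h := hGK.apply_mem_of_expK_stable ⟨_, upqZ0_coe_mem_compactLie (α := α) (β := β)⟩ (U := U)
    (fun t u hu => Submodule.mem_comap.mp (hK _ hu)) hu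
  rwa [inclusion_upqZ0] at h

/-- **Schur: `ρz₀` is a SCALAR on the image of an irreducible finite-dimensional `K`-type.**  For `τ` irreducible on `W` (finite-dimensional) and a
`K`-map `φ : τ → U` into a `K`-stable `U ≤ V` with its restricted action, there is `c : ℂ` with `ρz₀ (φ x) = c • φ x` for all `x` (`φ` is injective
or zero; `ρz₀` preserves the `K`-stable image and commutes with `K`, so `φ⁻¹ ∘ ρz₀ ∘ φ ∈ End_K(τ) = ℂ`, Mathlib
`Representation.IsIrreducible.algebraMap_intertwiningMap_bijective_of_isAlgClosed`). [cite: KnappVogan1995, §I.3 (before Prop. 1.63)]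
[cite: BorelWallach2000, 0 §2.4] -/
theorem exists_upqZ0_eq_smul_of_intertwiningMap (hGK : IsGKModule (uFormGroup α β) ρK ρ𝔤) {U : Submodule ℂ V}
    (hK : ∀ k : (uFormGroup α β).maximalCompact, U ≤ U.comap (ρK k))
    {W : Type} [AddCommGroup W] [Module ℂ W] [FiniteDimensional ℂ W] {τ : Representation ℂ (uFormGroup α β).maximalCompact W}
    (hτ : τ.IsIrreducible) (φ : τ.IntertwiningMap (ρK.subrepresentation U hK)) :
    ∃ c : ℂ, ∀ x : W, ρ𝔤 (upqZ0 α β) ((φ x : U) : V) = c • ((φ x : U) : V) := by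
  haveI := hτ
  rcases Representation.IsIrreducible.injective_or_eq_zero φ with hinj | h0
  swap
  · refine ⟨0, fun x => ?_⟩
    rw [h0, Representation.IntertwiningMap.coe_zero, Pi.zero_apply, Submodule.coe_zero, map_zero, smul_zero]
  -- `f = ι_U ∘ φ : W → V`, injective, `K`-equivariant
  set f : W →ₗ[ℂ] V := U.subtype ∘ₗ φ.toLinearMap with hf_def
  have hf_apply : ∀ x : W, f x = ((φ x : U) : V) := fun x => rfl
  have hf_inj : Function.Injective f := U.injective_subtype.comp hinj
  have hfK : ∀ (k : (uFormGroup α β).maximalCompact) (x : W), ρK k (f x) = f (τ k x) := by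
    intro k x
    rw [hf_apply, hf_apply, Representation.IntertwiningMap.isIntertwining _ _ φ k x]
    rfl
  -- the image is `K`-stable, hence `z₀`-stable
  have hrangeK : ∀ k : (uFormGroup α β).maximalCompact, LinearMap.range f ≤ (LinearMap.range f).comap (ρK k) := by
    rintro k _ ⟨x, rfl⟩
    exact ⟨τ k x, (hfK k x).symm⟩
  have hZmem : ∀ x : W, ρ𝔤 (upqZ0 α β) (f x) ∈ LinearMap.range f :=
    fun x => upqZ0_apply_mem_of_K_stable hGK hrangeK (LinearMap.mem_range_self f x)
  -- `S = f⁻¹ ∘ ρz₀ ∘ f : W → W`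
  set e : W ≃ₗ[ℂ] LinearMap.range f := LinearEquiv.ofInjective f hf_inj with he_def
  set g : W →ₗ[ℂ] LinearMap.range f := LinearMap.codRestrict (LinearMap.range f) (ρ𝔤 (upqZ0 α β) ∘ₗ f) hZmem with hg_def
  set S : W →ₗ[ℂ] W := e.symm.toLinearMap ∘ₗ g with hS_def
  have hfS : ∀ x : W, f (S x) = ρ𝔤 (upqZ0 α β) (f x) := by
    intro x
    have hSx : S x = e.symm (g x) := rfl
    calc f (S x) = ((e (S x) : LinearMap.range f) : V) := (LinearEquiv.ofInjective_apply (f := f) (h := hf_inj) (S x)).symm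
      _ = ((g x : LinearMap.range f) : V) := by rw [hSx, LinearEquiv.apply_symm_apply]
      _ = ρ𝔤 (upqZ0 α β) (f x) := rfl
  -- `S` commutes with `τ`
  have hSτ : ∀ (k : (uFormGroup α β).maximalCompact) (x : W), S (τ k x) = τ k (S x) := by
    intro k x
    apply hf_inj
    rw [hfS, ← hfK, ← hfK, hfS, K_upqZ0_comm hGK]
  -- Schur
  obtain ⟨c, hc⟩ := (Representation.IsIrreducible.algebraMap_intertwiningMap_bijective_of_isAlgClosed (ρ := τ)).2
    (LinearMap.intertwiningMap_of_isIntertwiningMap τ τ S hSτ)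
  refine ⟨c, fun x => ?_⟩
  have hSx : S x = c • x := by
    have h := congrArg (fun ψ : τ.IntertwiningMap τ => ψ x) hc
    simp only [Representation.IntertwiningMap.algebraMap_apply, Representation.IntertwiningMap.smul_apply,
      Representation.IntertwiningMap.coe_one, id] at h
    exact h.symm
  rw [← hf_apply, ← hfS, hSx, map_smul]

/-! ## §3 A `z₀`-eigenvector of `gen` lies in a single graded piece -/

/-- **A non-zero `z₀`-eigenvector of `gen ρ𝔤 μ E` lies in ONE graded piece `G_n`, and its eigenvalue is `w + nμ`** (induction along the filtration
`G₀ ⊔ ⋯ ⊔ G_m`, §1 independence). [cite: BorelWallach2000, II §4.1] [cite: KnappVogan1995, §II.4] -/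
theorem exists_grade_of_eigenvector (hμ : μ * μ = -1) {w : ℂ} (hw : ∀ e ∈ E, ρ𝔤 (upqZ0 α β) e = w • e)
    {v : V} (hv : v ∈ gen ρ𝔤 μ E) {a : ℂ} (ha : ρ𝔤 (upqZ0 α β) v = a • v) (hv0 : v ≠ 0) :
    ∃ n : ℕ, a = w + n * μ ∧ v ∈ grade ρ𝔤 μ E n := by
  have key : ∀ (m : ℕ) {v : V}, v ∈ partialSups (grade ρ𝔤 μ E) m → ρ𝔤 (upqZ0 α β) v = a • v → v ≠ 0 →
      ∃ n : ℕ, n ≤ m ∧ a = w + n * μ ∧ v ∈ grade ρ𝔤 μ E n := by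
    intro m
    induction m with
    | zero =>
      intro v hv ha hv0
      rw [partialSups_zero] at hv
      refine ⟨0, le_rfl, ?_, hv⟩
      have h1 : a • v = (w + ((0 : ℕ) : ℂ) * μ) • v := by rw [← ha, z0_apply_of_mem_grade hμ hw 0 hv]
      rw [← sub_eq_zero, ← sub_smul, smul_eq_zero] at h1
      rcases h1 with h1 | h1
      · exact sub_eq_zero.1 h1
      · exact absurd h1 hv0
    | succ m ih =>
      intro v hv ha hv0
      have hps : partialSups (grade ρ𝔤 μ E) (m + 1) = partialSups (grade ρ𝔤 μ E) m ⊔ grade ρ𝔤 μ E (m + 1) :=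
        partialSups_succ _ m
      rw [hps] at hv
      obtain ⟨u, hu, g, hg, rfl⟩ := Submodule.mem_sup.1 hv
      set c : ℂ := w + ((m + 1 : ℕ) : ℂ) * μ with hc_def
      have hTg : ρ𝔤 (upqZ0 α β) g = c • g := z0_apply_of_mem_grade hμ hw (m + 1) hg
      have hTu : ρ𝔤 (upqZ0 α β) u ∈ partialSups (grade ρ𝔤 μ E) m := upqZ0_apply_mem_partialSups hμ hw m hu
      -- `(ρz₀ - a) u = (a - c) g`, the two sides in independent subspaces
      have heq : ρ𝔤 (upqZ0 α β) u - a • u = (a - c) • g := by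
        rw [map_add, hTg, smul_add] at ha
        rw [sub_smul]
        exact sub_eq_sub_iff_add_eq_add.2 (ha.trans (add_comm _ _))
      have hl : ρ𝔤 (upqZ0 α β) u - a • u ∈ partialSups (grade ρ𝔤 μ E) m := Submodule.sub_mem _ hTu (Submodule.smul_mem _ _ hu)
      have hr : (a - c) • g ∈ grade ρ𝔤 μ E (m + 1) := Submodule.smul_mem _ _ hg
      have h0 : (a - c) • g = 0 :=
        (Submodule.disjoint_def.1 (disjoint_partialSups_grade_succ hμ hw m)) _ (heq ▸ hl) hr
      have hu_eig : ρ𝔤 (upqZ0 α β) u = a • u := by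
        rw [← sub_eq_zero, heq, h0]
      by_cases hg0 : g = 0
      · -- `v = u`
        have hu0 : u ≠ 0 := by rintro rfl; exact hv0 (by rw [hg0, add_zero])
        obtain ⟨n, hn, hn', hmem⟩ := ih hu hu_eig hu0
        exact ⟨n, hn.trans (Nat.le_succ m), hn', by rw [hg0, add_zero]; exact hmem⟩
      · -- `a = c` and `u = 0`
        have hac : a = c := by
          rcases smul_eq_zero.1 h0 with h | h
          · exact sub_eq_zero.1 h
          · exact absurd h hg0
        have hu0 : u = 0 := by
          by_contra hu0
          obtain ⟨n, hn, hn', -⟩ := ih hu hu_eig hu0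
          have : n = m + 1 := weight_injective hμ w (hn'.symm.trans hac)
          omega
        exact ⟨m + 1, le_rfl, hac, by rw [hu0, zero_add]; exact hg⟩
  -- `gen` is exhausted by the stages `G₀ ⊔ ⋯ ⊔ G_m`
  have hex : ∃ m : ℕ, v ∈ partialSups (grade ρ𝔤 μ E) m := by
    have h : gen ρ𝔤 μ E = ⨆ m, partialSups (grade ρ𝔤 μ E) m := (iSup_partialSups_eq _).symm
    rw [h] at hv
    exact (Submodule.mem_iSup_of_directed _ (partialSups (grade ρ𝔤 μ E)).monotone.directed_le).mp hv
  obtain ⟨m, hm⟩ := hex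
  obtain ⟨n, -, h1, h2⟩ := key m hm ha hv0
  exact ⟨n, h1, h2⟩

/-- **Two graded pieces carrying non-zero vectors whose SUM is a `z₀`-eigenvector (or zero) coincide** (independence of the pieces).
[cite: BorelWallach2000, II §4.1] -/
theorem eq_of_add_eigenvector (hμ : μ * μ = -1) {w : ℂ} (hw : ∀ e ∈ E, ρ𝔤 (upqZ0 α β) e = w • e) {n₁ n₀ : ℕ} {a b : V}
    (ha : a ∈ grade ρ𝔤 μ E n₁) (hb : b ∈ grade ρ𝔤 μ E n₀) (ha0 : a ≠ 0) (hb0 : b ≠ 0)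
    (hab : ∃ c : ℂ, ρ𝔤 (upqZ0 α β) (a + b) = c • (a + b)) : n₁ = n₀ := by
  by_contra hne
  obtain ⟨c, hc⟩ := hab
  have hTa := z0_apply_of_mem_grade hμ hw n₁ ha
  have hTb := z0_apply_of_mem_grade hμ hw n₀ hb
  -- `(c₁ - c) a = (c - c₀) b` with both sides in independent pieces
  have heq : (w + n₁ * μ - c) • a = (c - (w + n₀ * μ)) • b := by
    rw [map_add, hTa, hTb, smul_add] at hc
    rw [sub_smul, sub_smul]
    exact sub_eq_sub_iff_add_eq_add.2 (hc.trans (add_comm _ _))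
  have hl : (w + n₁ * μ - c) • a ∈ grade ρ𝔤 μ E n₁ := Submodule.smul_mem _ _ ha
  have hr : (c - (w + n₀ * μ)) • b ∈ grade ρ𝔤 μ E n₀ := Submodule.smul_mem _ _ hb
  have h0 : (w + n₁ * μ - c) • a = 0 := (Submodule.disjoint_def.1 (disjoint_grade_of_ne hμ hw hne)) _ hl (heq ▸ hr)
  have hc1 : c = w + n₁ * μ := by
    rcases smul_eq_zero.1 h0 with h | h
    · exact (sub_eq_zero.1 h).symm
    · exact absurd h ha0
  have h0' : (c - (w + n₀ * μ)) • b = 0 := by rw [← heq, h0]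
  have hc0 : c = w + n₀ * μ := by
    rcases smul_eq_zero.1 h0' with h | h
    · exact sub_eq_zero.1 h
    · exact absurd h hb0
  exact hne (weight_injective hμ w (hc1.symm.trans hc0))

/-! ## §4 Admissibility of the `K`-stable subspaces of `gen` -/

/-- **ADMISSIBILITY.**  In a `(𝔤, K)`-module of `U(α, β)`, every `K`-stable subspace `U ≤ gen ρ𝔤 μ E` of the subspace generated by a
FINITE-DIMENSIONAL `E` of `z₀`-weight `w` is admissible with its restricted `K`-action: for each irreducible finite-dimensional `K`-type `τ`,
`Hom_K(τ, U)` embeds linearly in `Hom_ℂ(τ, G_{n₀})` for ONE graded piece `G_{n₀}` (§2 Schur, §3), which is finite-dimensional (§1).  Consumed with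
`U = core` by ★ `F0P3ArchIsotypyOfIrreducibleCore.archIsotypy_of_core'` once `core ≤ gen` (★ B4a). [cite: BorelWallach2000, 0 §2.4; II §4.1]
[cite: KnappVogan1995, §I.3 (before Prop. 1.63); §II.4] [cite: HarishChandraTAMS1953, §9] -/
theorem isAdmissibleGK_subrepresentation_of_le_gen [FiniteDimensional ℂ E] (hGK : IsGKModule (uFormGroup α β) ρK ρ𝔤)
    (hμ : μ * μ = -1) {w : ℂ} (hw : ∀ e ∈ E, ρ𝔤 (upqZ0 α β) e = w • e)
    {U : Submodule ℂ V} (hK : ∀ k : (uFormGroup α β).maximalCompact, U ≤ U.comap (ρK k)) (hUle : U ≤ gen ρ𝔤 μ E) :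
    IsAdmissibleGK (V := ↥U) (ρK.subrepresentation U hK) := by
  intro W _ _ _ τ hτ
  haveI := hτ
  -- every `K`-map `τ → U` has its image in ONE graded piece
  have hone : ∀ φ : τ.IntertwiningMap (ρK.subrepresentation U hK), ∃ n : ℕ, ∀ x : W, ((φ x : U) : V) ∈ grade ρ𝔤 μ E n := by
    intro φ
    by_cases hφ : ∃ x : W, φ x ≠ 0
    swap
    · push Not at hφ
      exact ⟨0, fun x => by rw [hφ x, Submodule.coe_zero]; exact Submodule.zero_mem _⟩
    obtain ⟨x₀, hx₀⟩ := hφ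
    obtain ⟨c, hc⟩ := exists_upqZ0_eq_smul_of_intertwiningMap hGK hK hτ φ
    have hx₀' : ((φ x₀ : U) : V) ≠ 0 := fun h => hx₀ (Subtype.ext h)
    obtain ⟨n₀, hn₀, -⟩ := exists_grade_of_eigenvector hμ hw (hUle (φ x₀).2) (hc x₀) hx₀'
    refine ⟨n₀, fun x => ?_⟩
    by_cases hx : ((φ x : U) : V) = 0
    · rw [hx]; exact Submodule.zero_mem _
    obtain ⟨n, hn, hmem⟩ := exists_grade_of_eigenvector hμ hw (hUle (φ x).2) (hc x) hx
    have : n = n₀ := weight_injective hμ w (hn.symm.trans hn₀)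
    exact this ▸ hmem
  -- and all NON-ZERO `K`-maps see the SAME piece
  have huniform : ∃ n₀ : ℕ, ∀ (φ : τ.IntertwiningMap (ρK.subrepresentation U hK)) (x : W), ((φ x : U) : V) ∈ grade ρ𝔤 μ E n₀ := by
    by_cases hex : ∃ φ₀ : τ.IntertwiningMap (ρK.subrepresentation U hK), ∃ x₀ : W, φ₀ x₀ ≠ 0
    swap
    · push Not at hex
      exact ⟨0, fun φ x => by rw [hex φ x, Submodule.coe_zero]; exact Submodule.zero_mem _⟩
    obtain ⟨φ₀, x₀, hx₀⟩ := hex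
    obtain ⟨n₀, hn₀⟩ := hone φ₀
    refine ⟨n₀, fun φ x => ?_⟩
    obtain ⟨n₁, hn₁⟩ := hone φ
    by_cases hφx : ((φ x₀ : U) : V) = 0
    · -- `φ` kills `x₀ ≠ 0`, so `φ = 0`
      have hx₀ne : x₀ ≠ 0 := by rintro rfl; exact hx₀ (map_zero φ₀)
      have hφ0 : φ = 0 := by
        rcases Representation.IsIrreducible.injective_or_eq_zero φ with hinj | h0
        · exact absurd (hinj (a₁ := x₀) (a₂ := 0) (by rw [map_zero]; exact Subtype.ext hφx)) hx₀ne
        · exact h0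
      rw [hφ0, Representation.IntertwiningMap.coe_zero, Pi.zero_apply, Submodule.coe_zero]
      exact Submodule.zero_mem _
    -- apply §2 to `φ + φ₀` at `x₀`
    have hb0 : ((φ₀ x₀ : U) : V) ≠ 0 := fun h => hx₀ (Subtype.ext h)
    obtain ⟨c, hc⟩ := exists_upqZ0_eq_smul_of_intertwiningMap hGK hK hτ (φ + φ₀)
    have hsum : (((φ + φ₀) x₀ : U) : V) = ((φ x₀ : U) : V) + ((φ₀ x₀ : U) : V) := by
      rw [Representation.IntertwiningMap.coe_add, Pi.add_apply, Submodule.coe_add]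
    have h01 : n₁ = n₀ :=
      eq_of_add_eigenvector hμ hw (hn₁ x₀) (hn₀ x₀) hφx hb0 ⟨c, by rw [← hsum]; exact hc x₀⟩
    exact h01 ▸ hn₁ x
  obtain ⟨n₀, hn₀⟩ := huniform
  -- the graded pieces of the finite-dimensional `E` are finite-dimensional (`G_{n+1} = ⨆_s P(x_s) G_n`)
  have hfd : ∀ n : ℕ, FiniteDimensional ℂ (grade ρ𝔤 μ E n) := by
    intro n
    induction n with
    | zero => rw [grade_zero]; infer_instance
    | succ n ih =>
      rw [grade_succ]
      haveI := ih
      infer_instance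
  haveI := hfd n₀
  -- `Hom_K(τ, U) ↪ Hom_ℂ(W, G_{n₀})`
  let Θ : τ.IntertwiningMap (ρK.subrepresentation U hK) →ₗ[ℂ] (W →ₗ[ℂ] ↥(grade ρ𝔤 μ E n₀)) :=
    { toFun := fun φ => LinearMap.codRestrict (grade ρ𝔤 μ E n₀) (U.subtype ∘ₗ φ.toLinearMap) (hn₀ φ)
      map_add' := fun φ ψ => by ext x; rfl
      map_smul' := fun a φ => by ext x; rfl }
  have hΘ : Function.Injective Θ := by
    intro φ ψ h
    ext x
    have hx := congrArg (fun F : W →ₗ[ℂ] ↥(grade ρ𝔤 μ E n₀) => ((F x : grade ρ𝔤 μ E n₀) : V)) h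
    exact hx
  exact Module.Finite.of_injective Θ hΘ

/-- `gen ρ𝔤 μ E` is `K`-stable as soon as `E` is (★ `K_mem_grade`), in the `≤ comap` currency of `Representation.subrepresentation`.
[cite: BorelWallach2000, I §5.1 (1); II §4.1] -/
theorem gen_le_comap (hGK : IsGKModule (uFormGroup α β) ρK ρ𝔤)
    (hEK : ∀ (k : (uFormGroup α β).maximalCompact), ∀ e ∈ E, ρK k e ∈ E) (k : (uFormGroup α β).maximalCompact) :
    gen ρ𝔤 μ E ≤ (gen ρ𝔤 μ E).comap (ρK k) :=
  fun v hv => Submodule.iSup_induction _ (motive := fun v => ρK k v ∈ gen ρ𝔤 μ E) hv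
    (fun n u hu => grade_le_gen μ E n (K_mem_grade hGK.ad_compat hEK k n hu))
    (by rw [map_zero]; exact Submodule.zero_mem _) (fun x y hx hy => by rw [map_add]; exact Submodule.add_mem _ hx hy)

/-- **In particular `gen ρ𝔤 μ E` itself is admissible** (for a `K`-stable finite-dimensional `E` of `z₀`-weight `w`). [cite: BorelWallach2000, 0 §2.4; II §4.1]
[cite: KnappVogan1995, §I.3 (before Prop. 1.63)] -/
theorem isAdmissibleGK_subrepresentation_gen [FiniteDimensional ℂ E] (hGK : IsGKModule (uFormGroup α β) ρK ρ𝔤)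
    (hμ : μ * μ = -1) {w : ℂ} (hw : ∀ e ∈ E, ρ𝔤 (upqZ0 α β) e = w • e)
    (hEK : ∀ (k : (uFormGroup α β).maximalCompact), ∀ e ∈ E, ρK k e ∈ E) :
    IsAdmissibleGK (V := ↥(gen ρ𝔤 μ E)) (ρK.subrepresentation (gen ρ𝔤 μ E) (gen_le_comap hGK hEK)) :=
  isAdmissibleGK_subrepresentation_of_le_gen hGK hμ hw (gen_le_comap hGK hEK) le_rfl

end Summit.HodgeConjecture.HodgeConjecture.Cruxes.H413.F0P3GenAdmissible

end
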